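import Summits.Ventures.Crystal3D.Theorems.StickyWulffConstantGenericWallFloorBarlowOrbitFree
import Summits.Ventures.Crystal3D.Theorems.StickyWulffConstantGenericWallFloorBarlowZigzagCrossings
import HarnessLib

/-!
# Window families of cap-started walkers on a Barlow plate are END-INJECTIVE (discharging the orbit-freeness hypotheses)
# (crux `GenericWallFloor`, stmt-Ventures-19480, line `WallLedgerG`; G-side half of lane T's F4, cf-p1 §86(58) BA)

HONEST FRAMING. Venture `Summits/Ventures/Crystal3D` (cell `crystal3d-full`), helper `--supports` the crux `GenericWallFloor`
(stmt-Ventures-19480) of `route-Ventures-StickyWulffConstant`, registered line `WallLedgerG`, open stub `stub_twoSlabAdhesion`.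
Rung credit only; F-C1 not moved; NOT the stub.

`canon_walkRun_injOn` (`…BarlowOrbitFree`) makes a family of canonical cap-start states end-injective given three geometric
hypotheses: `hin` (each start's zigzag prefix of length `n i` lies in the complete region `R`), `hlines` (no start on another
start's prefix), `hexit` (every start strictly below every exit site).  This file DISCHARGES them for the families lane T's F4
uses (wulff-p2 15:37:57Z: one start per zigzag line, indexed by a vertex in a height window): a WINDOW FAMILY is a finite set of
start sites `p_i` (layer `mi i`) with `z`-heights `≥ H` whose zigzag PREDECESSORS `p_i − ms (mi i − 1)` lie strictly below `H`
(crossing sites of the plane `⟪·,z⟫ = H`, or lowest vertices of a band `[H, H+1]`), pairwise distinct; every model step rises by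
`≥ δ > 0` along `z`; and `R` contains every site of height in `[H, Ztop]` within distance `(Ztop − H)/δ + 1` of a start
(`Ztop ≥ H + 1`).  Then, with `n i` := the first index at which the zigzag of `i` rises above `Ztop`:

* `site_mem_barlowLayer` — the `k`-th zigzag site of a start is a site of layer `mi i + k` (pure lattice fact);
* `height_site_ge` — its height is `≥ H + k·δ`, and consecutive heights differ by `≤ 1`;
* **`windowFamily_walkRun_injOn`** — the canonical start states of a window family are mapped injectively by `walkRun X z N`
  (every `N`), modulo `E1` (`ExactOnly`) like every walk theorem.
WHAT THIS IS NOT: no count (`…TextureLiminfFluxCount`, wulff-p2), no sealing, no payer sum — F4 proper assembles those; the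
axis orientation here is «layer index increasing along z» (the other orientation is the mirrored word); F-C1 not moved.
-/

noncomputable section

namespace Summit.Ventures.Crystal3D.Theorems

open Finset
open Literature.MathematicalPhysics.StatisticalMechanics
open scoped InnerProductSpace

variable {X : Finset (EuclideanSpace ℝ (Fin 3))}

section Moved

variable (σ : ℤ → ℤ) (L : EuclideanSpace ℝ (Fin 3) ≃ₗᵢ[ℝ] EuclideanSpace ℝ (Fin 3)) (s₀ z v₀ : EuclideanSpace ℝ (Fin 3))
  (ms : ℤ → EuclideanSpace ℝ (Fin 3))

/-- **Zigzag sites are lattice sites, layer by layer** (no completeness needed): with model steps `ms` (`v₀` on Δ, the mirrored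
∇-slot on ∇), `barlowPos σ m i j + Σ_{k'<k} ms (m + k')` is a site of layer `m + k`. -/
theorem site_mem_barlowLayer (hσ : IsHaggSeq σ) (hv₀ : v₀ ∈ fccSlots) (hv₀2 : v₀ 2 = Real.sqrt (2 / 3))
    (hms₁ : ∀ m, σ m = 1 → ms m = v₀)
    (hms₂ : ∀ m, σ m = -1 → ms m =
      basalMirror (bestCapper (twinFrame L (L (EuclideanSpace.single (2 : Fin 3) (1 : ℝ)))) (L (EuclideanSpace.single (2 : Fin 3) (1 : ℝ))) z))
    (m i j : ℤ) : ∀ k : ℕ,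
      barlowPos 1 (Real.sqrt (2 / 3)) σ m i j + ∑ k' ∈ Finset.range k, ms (m + k') ∈ barlowLayer 1 (Real.sqrt (2 / 3)) σ (m + k) := by
  obtain ⟨hq, hq2⟩ := bestCapper_nabla_slot L z
  have hrpos : 0 < Real.sqrt (2 / 3) := Real.sqrt_pos.2 (by norm_num)
  -- one step from any site of layer `m'`
  have hone : ∀ (m' a b : ℤ), barlowPos 1 (Real.sqrt (2 / 3)) σ m' a b + ms m' ∈ barlowLayer 1 (Real.sqrt (2 / 3)) σ (m' + 1) := by
    intro m' a b
    rcases hσ m' with hm | hm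
    · rw [hms₁ m' hm]
      rcases barlow_delta_add_slot_mem σ m' a b hm hv₀ (by rw [hv₀2]; exact hrpos.le) with h | h
      · exfalso
        have h2 := apply_two_of_mem_barlowLayer h
        simp only [PiLp.add_apply, barlowPos_apply_two, hv₀2] at h2
        linarith
      · exact h
    · rw [hms₂ m' hm]
      rcases barlow_nabla_add_slot_mem σ m' a b hm hq (by rw [hq2]; linarith) with h | h
      · exfalso
        have h2 := apply_two_of_mem_barlowLayer h
        have hm2 : (basalMirror (bestCapper (twinFrame L (L (EuclideanSpace.single (2 : Fin 3) (1 : ℝ))))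
            (L (EuclideanSpace.single (2 : Fin 3) (1 : ℝ))) z)) 2 = Real.sqrt (2 / 3) := by
          rw [basalMirror_apply_coord]; simp [hq2]
        simp only [PiLp.add_apply, barlowPos_apply_two, hm2] at h2
        linarith
      · exact h
  intro k
  induction k with
  | zero => simp only [Finset.range_zero, Finset.sum_empty, add_zero, Nat.cast_zero]; exact ⟨i, j, rfl⟩
  | succ k ih =>
    obtain ⟨a, b, hab⟩ := ih
    rw [Finset.sum_range_succ, ← add_assoc, hab]
    have e : m + ((k + 1 : ℕ) : ℤ) = m + (k : ℤ) + 1 := by push_cast; ring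
    rw [e]
    exact hone _ a b

/-- **Heights along a zigzag.**  If every model step rises by `≥ δ` along `z`, the `k`-th site is at height `≥` start `+ k·δ`;
consecutive sites differ in height by at most `1` when the steps are unit vectors. -/
theorem height_site_ge {δ : ℝ} (hδ : ∀ m, δ ≤ ⟪L (ms m), z⟫_ℝ) (p : EuclideanSpace ℝ (Fin 3)) (m : ℤ) :
    ∀ k : ℕ, ⟪L p + s₀, z⟫_ℝ + k * δ ≤ ⟪L (p + ∑ k' ∈ Finset.range k, ms (m + k')) + s₀, z⟫_ℝ := by
  intro k
  induction k with
  | zero => simp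
  | succ k ih =>
    rw [Finset.sum_range_succ, ← add_assoc, map_add]
    have e : ⟪L (p + ∑ k' ∈ Finset.range k, ms (m + k')) + L (ms (m + k)) + s₀, z⟫_ℝ =
        ⟪L (p + ∑ k' ∈ Finset.range k, ms (m + k')) + s₀, z⟫_ℝ + ⟪L (ms (m + k)), z⟫_ℝ := by
      rw [show L (p + ∑ k' ∈ Finset.range k, ms (m + k')) + L (ms (m + ↑k)) + s₀ =
        (L (p + ∑ k' ∈ Finset.range k, ms (m + k')) + s₀) + L (ms (m + ↑k)) by abel, inner_add_left]
    rw [e]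
    have := hδ (m + k)
    push_cast
    linarith

/-- One step changes the height by at most `1` (unit steps, unit `z`). -/
theorem height_step_le (hz : ‖z‖ = 1) (hms : ∀ m, ‖ms m‖ = 1) (p : EuclideanSpace ℝ (Fin 3)) (m : ℤ) :
    ⟪L (p + ms m) + s₀, z⟫_ℝ ≤ ⟪L p + s₀, z⟫_ℝ + 1 := by
  rw [map_add, show L p + L (ms m) + s₀ = (L p + s₀) + L (ms m) by abel, inner_add_left]
  have h := real_inner_le_norm (L (ms m)) z
  rw [LinearIsometryEquiv.norm_map, hms, hz, one_mul] at h
  linarith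

variable (canon : ℤ → EuclideanSpace ℝ (Fin 3) → EuclideanSpace ℝ (Fin 3) × List WalkEntry)

open scoped Classical in
/-- **Window families are end-injective.**  See the module docstring.  Hypotheses: the walk's standing inputs (`hX₁`, E1 as
`hs₁/hcert`, unit `z`), the canonical states / model steps of `…BarlowPrefix` (`hcanon₁/₂`, `hms₁/₂`), unit steps rising by
`≥ δ > 0`, the complete region `R` (`hR`) containing every site of height in `[H, Ztop]` within distance `(Ztop − H)/δ + 1` of a
start (`hRin`), `Ztop ≥ H + 1`; the family: start sites `p_i = barlowPos σ (mi i) (ai i) (bi i)` of heights `≥ H`, zigzag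
predecessors below `H`, pairwise distinct, canonical start states valid.  Conclusion: `walkRun X z N` is injective on the family. -/
theorem windowFamily_walkRun_injOn (hσ : IsHaggSeq σ) (hX₁ : ∀ p ∈ X, ∀ q ∈ X, p ≠ q → 1 ≤ dist p q)
    {s₁ : EuclideanSpace ℝ (Fin 3)} (hs₁ : s₁ ∈ fccSlots) (hcert : ExactOnly 0 (fccSlots.filter fun w => 0 < ⟪w, s₁⟫_ℝ))
    (hz : ‖z‖ = 1) (hv₀ : v₀ ∈ fccSlots) (hv₀2 : v₀ 2 = Real.sqrt (2 / 3))
    (hcanon₁ : ∀ m t, σ (m - 1) = 1 → canon m t = (t, [⟨L, v₀, 0⟩]))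
    (hcanon₂ : ∀ m t, σ (m - 1) = -1 → canon m t =
      (t, [⟨twinFrame L (L (EuclideanSpace.single (2 : Fin 3) (1 : ℝ))),
            bestCapper (twinFrame L (L (EuclideanSpace.single (2 : Fin 3) (1 : ℝ)))) (L (EuclideanSpace.single (2 : Fin 3) (1 : ℝ))) z,
            L (EuclideanSpace.single (2 : Fin 3) (1 : ℝ))⟩, ⟨L, v₀, 0⟩]))
    (hms₁ : ∀ m, σ m = 1 → ms m = v₀)
    (hms₂ : ∀ m, σ m = -1 → ms m =
      basalMirror (bestCapper (twinFrame L (L (EuclideanSpace.single (2 : Fin 3) (1 : ℝ)))) (L (EuclideanSpace.single (2 : Fin 3) (1 : ℝ))) z))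
    {δ : ℝ} (hδ0 : 0 < δ) (hδ : ∀ m, δ ≤ ⟪L (ms m), z⟫_ℝ)
    (R : Set (EuclideanSpace ℝ (Fin 3)))
    (hR : ∀ m i j : ℤ, barlowPos 1 (Real.sqrt (2 / 3)) σ m i j ∈ R →
      ∀ q ∈ barlowStacking 1 (Real.sqrt (2 / 3)) σ, dist q (barlowPos 1 (Real.sqrt (2 / 3)) σ m i j) ≤ 1 → L q + s₀ ∈ X)
    (H Ztop : ℝ) (hHZ : H + 1 ≤ Ztop)
    {ι : Type*} (T : Finset ι) (mi ai bi : ι → ℤ)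
    (hRin : ∀ i ∈ T, ∀ m a b : ℤ,
      H ≤ ⟪L (barlowPos 1 (Real.sqrt (2 / 3)) σ m a b) + s₀, z⟫_ℝ →
      ⟪L (barlowPos 1 (Real.sqrt (2 / 3)) σ m a b) + s₀, z⟫_ℝ ≤ Ztop →
      ‖barlowPos 1 (Real.sqrt (2 / 3)) σ m a b - barlowPos 1 (Real.sqrt (2 / 3)) σ (mi i) (ai i) (bi i)‖ ≤ (Ztop - H) / δ + 1 →
      barlowPos 1 (Real.sqrt (2 / 3)) σ m a b ∈ R)
    (hlow : ∀ i ∈ T, H ≤ ⟪L (barlowPos 1 (Real.sqrt (2 / 3)) σ (mi i) (ai i) (bi i)) + s₀, z⟫_ℝ)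
    (hpred : ∀ i ∈ T, ⟪L (barlowPos 1 (Real.sqrt (2 / 3)) σ (mi i) (ai i) (bi i) - ms (mi i - 1)) + s₀, z⟫_ℝ < H)
    (hinjT : ∀ i ∈ T, ∀ j ∈ T,
      barlowPos 1 (Real.sqrt (2 / 3)) σ (mi i) (ai i) (bi i) = barlowPos 1 (Real.sqrt (2 / 3)) σ (mi j) (ai j) (bi j) → i = j)
    (hvalid : ∀ i ∈ T, WalkInv X z (canon (mi i) (L (barlowPos 1 (Real.sqrt (2 / 3)) σ (mi i) (ai i) (bi i)) + s₀)) ∧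
      StackWF z (canon (mi i) (L (barlowPos 1 (Real.sqrt (2 / 3)) σ (mi i) (ai i) (bi i)) + s₀)).2)
    (N : ℕ) :
    ∀ i ∈ T, ∀ j ∈ T,
      walkRun X z N (canon (mi i) (L (barlowPos 1 (Real.sqrt (2 / 3)) σ (mi i) (ai i) (bi i)) + s₀)) =
        walkRun X z N (canon (mi j) (L (barlowPos 1 (Real.sqrt (2 / 3)) σ (mi j) (ai j) (bi j)) + s₀)) → i = j := by
  -- notation
  set bp : ℤ → ℤ → ℤ → EuclideanSpace ℝ (Fin 3) := fun m a b => barlowPos 1 (Real.sqrt (2 / 3)) σ m a b with hbp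
  set site : ι → ℕ → EuclideanSpace ℝ (Fin 3) :=
    fun i k => bp (mi i) (ai i) (bi i) + ∑ k' ∈ Finset.range k, ms (mi i + k') with hsite
  set ht : EuclideanSpace ℝ (Fin 3) → ℝ := fun p => ⟪L p + s₀, z⟫_ℝ with hht
  have hms : ∀ m, ‖ms m‖ = 1 := by
    intro m
    rcases hσ m with h | h
    · rw [hms₁ m h, norm_eq_one_of_mem_fccSlots hv₀]
    · rw [hms₂ m h, LinearIsometryEquiv.norm_map, norm_eq_one_of_mem_fccSlots (bestCapper_nabla_slot L z).1]
  -- heights along the zigzags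
  have hgrow : ∀ i (k : ℕ), ht (bp (mi i) (ai i) (bi i)) + k * δ ≤ ht (site i k) := fun i k => by
    simp only [hht, hsite]; exact height_site_ge L s₀ z ms hδ _ (mi i) k
  have hsucc : ∀ i (k : ℕ), site i (k + 1) = site i k + ms (mi i + k) := fun i k => by
    simp only [hsite]; rw [Finset.sum_range_succ, add_assoc]
  -- exit indices
  set K₀ : ℕ := ⌈(Ztop - H) / δ⌉₊ + 1 with hK₀
  have hZH : 0 ≤ (Ztop - H) / δ := div_nonneg (by linarith) hδ0.le
  have hK₀gt : (Ztop - H) / δ < ((K₀ : ℕ) : ℝ) := by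
    rw [hK₀]; push_cast; have := Nat.le_ceil ((Ztop - H) / δ); linarith
  have hK₀le : ((K₀ : ℕ) : ℝ) ≤ (Ztop - H) / δ + 2 := by
    rw [hK₀]; push_cast; have := Nat.ceil_lt_add_one hZH; linarith
  have hex : ∀ i ∈ T, ∃ k : ℕ, Ztop < ht (site i k) := by
    intro i hi
    refine ⟨K₀, lt_of_lt_of_le ?_ (hgrow i K₀)⟩
    have h1 := hlow i hi
    have h2 : Ztop - H < (K₀ : ℝ) * δ := by
      rw [div_lt_iff₀ hδ0] at hK₀gt; linarith
    show Ztop < ht (bp (mi i) (ai i) (bi i)) + K₀ * δ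
    simp only [hht] at h1 ⊢; linarith
  set n : ι → ℕ := fun i => if hi : i ∈ T then Nat.find (hex i hi) else 0 with hn
  have hn_spec : ∀ i (hi : i ∈ T), Ztop < ht (site i (n i)) := by
    intro i hi; simp only [hn, dif_pos hi]; exact Nat.find_spec (hex i hi)
  have hn_min : ∀ i (hi : i ∈ T), ∀ k < n i, ht (site i k) ≤ Ztop := by
    intro i hi k hk
    simp only [hn, dif_pos hi] at hk
    have := Nat.find_min (hex i hi) hk
    push Not at this; exact this
  have hn_le : ∀ i (hi : i ∈ T), n i ≤ K₀ := by
    intro i hi; simp only [hn, dif_pos hi]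
    exact Nat.find_le (by
      refine lt_of_lt_of_le ?_ (hgrow i K₀)
      have h1 := hlow i hi
      have h2 : Ztop - H < (K₀ : ℝ) * δ := by rw [div_lt_iff₀ hδ0] at hK₀gt; linarith
      show Ztop < ht (bp (mi i) (ai i) (bi i)) + K₀ * δ
      simp only [hht] at h1 ⊢; linarith)
  -- the three hypotheses of `canon_walkRun_injOn`
  have hin : ∀ i ∈ T, ∀ k < n i, site i k ∈ R := by
    intro i hi k hk
    obtain ⟨a, b, hab⟩ := site_mem_barlowLayer σ L z v₀ ms hσ hv₀ hv₀2 hms₁ hms₂ (mi i) (ai i) (bi i) k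
    have hab' : site i k = bp (mi i + k) a b := hab
    have f1 : H ≤ ht (site i k) := by
      have h1 := hgrow i k; have h2 := hlow i hi
      have h3 : (0 : ℝ) ≤ k * δ := by positivity
      simp only [hht, hsite, hbp] at h1 h2 ⊢; linarith
    have f2 : ht (site i k) ≤ Ztop := hn_min i hi k hk
    have f3 : ‖site i k - bp (mi i) (ai i) (bi i)‖ ≤ (Ztop - H) / δ + 1 := by
      have hd : site i k - bp (mi i) (ai i) (bi i) = ∑ k' ∈ Finset.range k, ms (mi i + k') := by simp only [hsite]; abel
      rw [hd]
      calc ‖∑ k' ∈ Finset.range k, ms (mi i + k')‖ ≤ ∑ k' ∈ Finset.range k, ‖ms (mi i + k')‖ := norm_sum_le _ _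
        _ = k := by simp [hms]
        _ ≤ (Ztop - H) / δ + 1 := by
            have hk' : (k : ℝ) + 1 ≤ (n i : ℕ) := by exact_mod_cast hk
            have hni : ((n i : ℕ) : ℝ) ≤ K₀ := by exact_mod_cast hn_le i hi
            linarith
    rw [hab'] at f1 f2 f3 ⊢
    exact hRin i hi (mi i + k) a b f1 f2 f3
  have hexit : ∀ i ∈ T, ∀ j ∈ T, ht (bp (mi j) (ai j) (bi j)) < ht (site i (n i)) := by
    intro i hi j hj
    have h1 := hn_spec i hi
    have h2 : ht (bp (mi j) (ai j) (bi j)) < H + 1 := by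
      have h3 := hpred j hj
      have h4 := height_step_le L s₀ z ms hz hms (bp (mi j) (ai j) (bi j) - ms (mi j - 1)) (mi j - 1)
      rw [sub_add_cancel] at h4
      simp only [hht]; linarith
    linarith
  have hlines : ∀ i ∈ T, ∀ j ∈ T, i ≠ j → ∀ k ≤ n i, site i k ≠ bp (mi j) (ai j) (bi j) := by
    intro i hi j hj hij k hk heq
    rcases Nat.eq_zero_or_pos k with hk0 | hkpos
    · subst hk0
      have : site i 0 = bp (mi i) (ai i) (bi i) := by simp [hsite]
      rw [this] at heq
      exact hij (hinjT i hi j hj heq)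
    · -- the predecessor of `p_j` is site `k - 1` of `i`, at height ≥ H
      obtain ⟨k₁, rfl⟩ := Nat.exists_eq_add_of_lt hkpos
      simp only [zero_add] at heq hk
      obtain ⟨a, b, hab⟩ := site_mem_barlowLayer σ L z v₀ ms hσ hv₀ hv₀2 hms₁ hms₂ (mi i) (ai i) (bi i) (k₁ + 1)
      have hab' : site i (k₁ + 1) = bp (mi i + ((k₁ + 1 : ℕ) : ℤ)) a b := hab
      have hlayer : mi i + ((k₁ + 1 : ℕ) : ℤ) = mi j := by
        rw [hab'] at heq
        exact (barlowPos_injective σ heq).1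
      have hpredeq : bp (mi j) (ai j) (bi j) - ms (mi j - 1) = site i k₁ := by
        rw [← heq, hsucc, ← hlayer]
        have e : mi i + ((k₁ + 1 : ℕ) : ℤ) - 1 = mi i + (k₁ : ℤ) := by push_cast; ring
        rw [e, add_sub_cancel_right]
      have h1 := hpred j hj
      rw [hpredeq] at h1
      have h2 := hgrow i k₁; have h3 := hlow i hi
      have h4 : (0 : ℝ) ≤ k₁ * δ := by positivity
      simp only [hht] at h1 h2 h3
      linarith
  exact canon_walkRun_injOn σ L s₀ z v₀ canon ms hσ hX₁ hs₁ hcert hz hv₀ hv₀2 hcanon₁ hcanon₂ hms₁ hms₂ R hR T mi ai bi n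
    hin hvalid hlines hexit N

end Moved

end Summit.Ventures.Crystal3D.Theorems

end
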